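import Mathlib.Tactic.Linarith
import Mathlib.Tactic.Ring
import Mathlib.Tactic.NormNum
import Mathlib.Tactic.IntervalCases
import Mathlib.Algebra.BigOperators.Group.Finset.Basic
import HarnessLib

/-!
# The (0,1) cell of the ι-window, EXISTENCE side, XVIII: zero-dimensional junk at two-torsion points is never rigid —
# the row (R16-e) of the 2Θ-habitat; arithmetic skeleton of `H2-EXISTENCE-SIDE-18.md`

Family `hodge`, b2b cell `hweil`, `Summits/HodgeConjecture/HodgeConjecture/Theorems` (helper of item stmt-HodgeConjecture-2524, the
Weil-sixfold rung the H2 test serves). Companion to `WeilTypeLadderH2TwoThetaHabitat.lean` ([XVI]) and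
`WeilTypeLadderH2AbelPrymEigenbundles.lean` ([XVII]).

Setting (report §1; notation of [XVI]/[XVII]). `(A, Θ)` a principally polarised abelian fourfold, `ι = −1_A`; `a ∈ A°`, `S_a = Θ_a ∩ Θ_{−a}`,
`D ∈ ℙ(Λ_a) ⊂ |2Θ|` an irreducible normal member through `S_a` with rational singularities; the normal form of [XVI] COROLLARY A2: an
H2-numerical torsion-free rank-one sheaf `F ⊂ 𝓛`, `𝓛 ∈ {𝒪_D(Θ + S_a) ⊗ P, 𝒪_D(2Θ − S_a) ⊗ P}`, `T = 𝓛/F`, with one-dimensional part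
`T′ = 𝓛|_Z` on an integral `ι`-invariant carrier `Z` of class `2γ` along which `𝓛` is invertible, and zero-dimensional part `T₀` ('junk') of
length `ℓ`. The local index at an `ι`-fixed point `x` is the supertrace `t_x(N) = Σ_i (−1)^i tr(ι | Tor_i^{𝒪_A}(N, k_x))`; for a finite-length
`ι`-module `N` at `x` it equals `16·(dim N⁺ − dim N⁻)` (LEMMA T: Koszul resolution of `k_x`, `ι = −1` on `T_x^*A`), so `t ≡ 0` forces every local
piece of the junk to be BALANCED (`dim⁺ = dim⁻`), in particular of even length; `χ(T) = 4` forces `ℓ ∈ {2, 4}` (LEMMA L); junk at non-fixed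
points forces `e₁^ι ≥ 2` (LEMMA NF). THEOREM 1 (report §2): at a singular point `x` of `D` with even local equation (`ι = −1` on `T_xA`,
embedding dimension `4`) the punctual `ι`-Hilbert scheme of colength `2` is `ℙ(T_x^*A) ≅ ℙ³` (all points balanced), and the balanced part of
colength `4` is the disjoint union of the curvilinear stratum (odd `3`-jets `vt + wt³` on the tangent cone; at fixed `v` an `𝔸³` of ideals) and
the `(1,2,1)` stratum (`J = L ⊕ K̂ ⊕ 𝔪³`, `L ∈ Gr(2, 4)`, `K̂` a hyperplane of quadrics containing `L·V + k·q`: a `ℙ¹`-bundle over the open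
set `q|_Π ≢ 0`, `ℙ²` fibres over isotropic planes) — every balanced point lies on an irreducible family of balanced points of dimension `≥ 2`;
at an ordinary node the isolated `ι`-fixed points of the punctual Hilbert scheme of ANY colength are exactly the powers `𝔪ⁿ` (`SO(4) × 𝔾_m`
acts; the degree-`n` piece of `k[z₁..z₄]/(q)` is the irreducible representation `V_n ⊠ V_n` of dimension `(n+1)²`), of colength
`n(n+1)(2n+1)/6` and character imbalance `±n(n+1)/2 ≠ 0`. THEOREM 2 (report §3): hence every configuration of the normal form with junk at
a two-torsion point off the carrier lies in an effective flat family of simple `ι`-sheaves with constant `(v, t)` of dimension `≥ 2` obtained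
by moving the junk alone — `e₁^ι ≥ 2`, NOT an H2 object: the row (R16-e) of [XVI] 3.3 (d) is DEAD off the carrier, on every ppav fourfold.
THEOREM 3 (report §4): at the node `c` of a nodal Abel–Prym carrier `Z_c` the module `M = 𝓘_{Z_c} 𝒪_{D,c}` is `(z₃, z₄)𝒪_D` with its Koszul
relation when the quadratic part of `D` does not vanish on the tangent plane of `Z_c` (`α ≠ 0`), and `3`-generated otherwise; its balanced
`ι`-Quot scheme of length `2` is a `ℙ²`-bundle over `ℙ¹` (`α ≠ 0`) resp. the closure of two irreducible `3`-dimensional families (`α = 0`);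
of length `4` it is a Grassmannian `Gr(5, 7)` plus cyclic families of dimension `≥ 3` (`α ≠ 0`) resp. six explicit types, each point in
the closure of an irreducible family of dimension `≥ 3` (`α = 0`) — (R16-e) is DEAD at the carrier's node too. PROPOSITION 4 (report §5): through a node `p` of `D` on `S_a` the junk-free
sheaf is canonical (`T = 𝓛|_Z` modulo its length-one torsion at each node), the numerics read `n_Γ = 4 + ℓ` resp. `n_S = 4 + ℓ` with
`n_S + n_Γ = 8 + δ`, `δ_p = min(o_x, o_y) + min(o_x, o_z) − o_x ≥ 1` at each node (from `o_x + o_w = o_y + o_z`), and the (R16-a) sub-incidence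
has components of dimension `≥ 2` except over the rank strata `ρ ∈ {1, 2, 3}` — the habitat's last candidate cells on a general fourfold.

Def-free, fully proved ELEMENTARY statements (integer bookkeeping: the supertrace, the junk lengths, the Hilbert functions, the family
dimensions, the square-pyramidal colengths and their imbalance, the node excess, the sub-incidence table); the geometry is in the docstrings
and the report `run/shared/lean/b2b/hodge-weil/b2b-hweil-pv3-g25/H2-EXISTENCE-SIDE-18.md`. HONEST FRAMING: structure / census results about
one cell of the ladder's H2 test on the existence side; no case of the Hodge conjecture is proved; nothing here is a rung; no statement of
[Markman 2025] is used; nothing here depends on (LP), (8.3.3), (GP17), (GP18) or (S). 0 unconditional rungs above the floor.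
-/

set_option linter.dupNamespace false

open Finset

namespace Summit.HodgeConjecture.HodgeConjecture.WeilTypeLadder

section H2TorsionJunk

/-- LEMMA T (the supertrace of a finite `ι`-module at a fixed point). `Tor_i^{𝒪_A}(k_x, k_x) = Λ^i T_x^*A` with `ι` acting by `(−1)^i`
(`ι = −1` on the `4`-dimensional cotangent space), so the skyscraper `k_x` with character `ε` has supertrace
`ε·Σ_i (−1)^i·(−1)^i·C(4,i) = 16ε`; by additivity over an `ι`-stable composition series a finite-length `ι`-module `N` at `x` has
`t_x(N) = 16·(dim N⁺ − dim N⁻)`, which vanishes iff `N` is BALANCED. Recorded: the binomial sum and the equivalence. [report §1.2] -/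
theorem supertrace_balanced (np nm t : ℤ) (ht : t = 16 * (np - nm)) :
    ((1 : ℤ) * 1 + (-1) * (-4) + 1 * 6 + (-1) * (-4) + 1 * 1 = 16) ∧ (t = 0 ↔ np = nm) := by
  refine ⟨by norm_num, ?_⟩
  subst ht; omega

/-- LEMMA L (junk lengths), first hull `𝓛 = 𝒪_D(Θ + S_a) ⊗ P`: `deg 𝓛|_Z = 8 + m` with `m = (S_a·Z)_D = length(𝒪_Z/𝓘_{S_a}𝒪_Z) ≥ 0`
intrinsic to `(a, Z)` and EVEN (`Z ∩ S_a` is `ι`-invariant without fixed points), `χ(𝓛|_Z) = m` (`p_a(Z) = 9`), `χ(T) = m + ℓ = 4`; so a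
non-zero junk has `(m, ℓ) ∈ {(0, 4), (2, 2)}`. Recorded: the arithmetic. [report §1.3] -/
theorem junk_length_first_hull (m ℓ : ℤ) (hχ : m + ℓ = 4) (hm : 0 ≤ m) (heven : m % 2 = 0) (hℓ : 0 < ℓ) :
    (m = 0 ∧ ℓ = 4) ∨ (m = 2 ∧ ℓ = 2) := by
  omega

/-- LEMMA L, second hull `𝓛 = 𝒪_D(2Θ − S_a) ⊗ P`: `deg 𝓛|_Z = 16 − m`, `χ(𝓛|_Z) = 8 − m`, `χ(T) = 8 − m + ℓ = 4`, and `m ≤ (Θ_a·Z) = 8`; so a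
non-zero junk has `(m, ℓ) ∈ {(6, 2), (8, 4)}`. In both hulls `ℓ ∈ {2, 4}`. Recorded: the arithmetic. [report §1.3] -/
theorem junk_length_second_hull (m ℓ : ℤ) (hχ : 8 - m + ℓ = 4) (hm : m ≤ 8) (heven : m % 2 = 0) (hℓ : 0 < ℓ) :
    (m = 6 ∧ ℓ = 2) ∨ (m = 8 ∧ ℓ = 4) := by
  omega

/-- LEMMA L, the local pieces: by LEMMA T each local piece of the junk at a two-torsion point is balanced, hence of even length `≥ 2`; with
`ℓ ≤ 4` the junk sits at one point (length `2` or `4`) or at two points (lengths `2 + 2`), never at three. Recorded: the partition count.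
[report §1.3] -/
theorem junk_local_pieces (a b c : ℕ) (ha : 2 ≤ a) (hb : 2 ≤ b) :
    (a + b ≤ 4 → a = 2 ∧ b = 2) ∧ (2 ≤ c → ¬ (a + b + c ≤ 4)) ∧ (a ≤ 4 → a % 2 = 0 → a = 2 ∨ a = 4) := by
  refine ⟨by omega, by omega, by omega⟩

/-- THEOREM 1 (a): at a point `x` where `D` is singular (local equation in `𝔪_x²`; automatic at every two-torsion point of `D`, all sections of
`2Θ` being even) the ideals of colength `2` of `𝒪_{D,x}` are `𝔪² + H` for the hyperplanes `H ⊂ 𝔪/𝔪² ≅ k⁴`: the punctual Hilbert scheme of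
colength `2` is `ℙ³`, every point `ι`-stable and balanced (`𝒪/J = k·1 ⊕ k·n̄`, characters `ε, −ε`). Recorded: `dim = e − 1 = 3 ≥ 2` for
embedding dimension `e = 4`. [report §2.1] -/
theorem hilb_two_is_P3 (e : ℕ) (he : e = 4) : e - 1 = 3 ∧ 2 ≤ e - 1 := by
  subst he; norm_num

/-- THEOREM 1 (b): the Hilbert function `(1, h₁, h₂, h₃, …)` of a balanced `ι`-stable ideal of colength `4` (`ι` acts by `(−1)^j` on the
`j`-th graded piece, so balance reads `1 + h₂ = h₁ + h₃`): exactly `(1, 2, 1)` or `(1, 1, 1, 1)` (curvilinear); `(1, 3)` is unbalanced.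
Recorded: the enumeration (`h₁ ≥ 1` since the colength exceeds `1`; `h₄ = 0` since `h₂ + h₄ ≤ 1` and `h₂ = 0 ⇒ h₄ = 0`). [report §2.2] -/
theorem balanced_hilbert_functions_four (h1 h2 h3 : ℕ) (hsum : 1 + h1 + h2 + h3 = 4) (h1pos : 1 ≤ h1)
    (hbal : 1 + h2 = h1 + h3) : (h1 = 2 ∧ h2 = 1 ∧ h3 = 0) ∨ (h1 = 1 ∧ h2 = 1 ∧ h3 = 1) := by
  omega

/-- THEOREM 1 (c), the curvilinear stratum: balanced `ι`-stable curvilinear ideals of colength `4` containing the equation of `D` are the ideals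
of the odd `3`-jets `γ(t) = vt + wt³` with `v` on the tangent cone `{q = 0} ⊂ T_xA` (`f(γ) ≡ q(v)t² mod t⁴`), modulo the reparametrisations
`t ↦ αt + βt³`; at FIXED `v` the ideals are parametrised injectively by `w ∈ T_xA/k·v ≅ 𝔸³` (the functional `g₁ ↦ g₁(w)` on `ann(v)` is read
off `J`). Recorded: the dimension counts `(3 + 4) − 2 = 5` (cone of a non-zero quadric), `(4 + 4) − 2 = 6` (`q = 0`), and `4 − 1 = 3 ≥ 2` at
fixed `v`. [report §2.3] -/
theorem curvilinear_family_dims (c : ℕ) (hc : c = 3 ∨ c = 4) :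
    5 ≤ c + 4 - 2 ∧ 4 - 1 = 3 ∧ 2 ≤ 4 - 1 := by
  rcases hc with h | h <;> subst h <;> norm_num

/-- THEOREM 1 (c), the `(1,2,1)` stratum: `J = L ⊕ K̂ ⊕ 𝔪³` with `L ⊂ V = 𝔪/𝔪²` a `2`-plane of linear forms and `K̂ ⊂ Sym²V` (`dim 10`) a
hyperplane containing `L·V` (the quadrics vanishing on the `2`-plane `Π = L^⊥`: codimension `dim Sym²(k²) = 3`, so `dim L·V = 7`) and `q`.
If `q|_Π ≢ 0`: `dim(L·V + kq) = 8`, the admissible `K̂` form a `ℙ¹`, and over the irreducible open set `{Π : q|_Π ≢ 0} ⊂ Gr(2,4)` (`dim 4`)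
the stratum is a `ℙ¹`-bundle of dimension `5`; if `q|_Π ≡ 0`: the `K̂` form a `ℙ²` at fixed `Π`. Either way every point lies on an irreducible
family of balanced ideals of dimension `≥ 2`. Recorded: the counts. [report §2.4] -/
theorem one_two_one_family_dims :
    (10 : ℤ) - 3 = 7 ∧ (10 : ℤ) - (7 + 1) - 1 = 1 ∧ (2 : ℤ) * (4 - 2) = 4 ∧ (4 : ℤ) + 1 = 5 ∧ (10 : ℤ) - 7 - 1 = 2 ∧
    (2 : ℤ) ≤ 5 ∧ (2 : ℤ) ≤ 2 := by
  norm_num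

/-- THEOREM 1 (d) (why balanced junk at a node can never be rigid, all colengths): `SO(q) × 𝔾_m` acts on the punctual `ι`-Hilbert scheme of the
threefold node `k[[z₁..z₄]]/(q)` (formal `ι`-equivariant Morse lemma), isolated points are fixed by this connected group, and the fixed ideals
of finite colength are the `𝔪ⁿ`: the degree-`n` piece of `k[z]/(q)` is the space of sections of `𝒪(n,n)` on the Segre quadric, the irreducible
`SO(4)`-representation `V_n ⊠ V_n` of dimension `C(n+3,3) − C(n+1,3) = (n+1)²`. Recorded: the dimension identity. [report §2.5] -/
theorem harmonic_piece_dim (n : ℤ) : (n + 3) * (n + 2) * (n + 1) - (n + 1) * n * (n - 1) = 6 * (n + 1) ^ 2 := by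
  ring

/-- THEOREM 1 (d), the colengths of the fixed ideals: `colength 𝔪ⁿ = Σ_{j<n} (j+1)² = n(n+1)(2n+1)/6` (square-pyramidal numbers
`0, 1, 5, 14, 30, …`). Recorded: the closed form, by induction. [report §2.5] -/
theorem square_pyramidal (n : ℕ) : 6 * (∑ j ∈ range n, (j + 1) ^ 2) = n * (n + 1) * (2 * n + 1) := by
  induction n with
  | zero => simp
  | succ n ih => rw [sum_range_succ, mul_add, ih]; ring

/-- THEOREM 1 (d), the character imbalance of the fixed ideals: `dim (𝒪/𝔪ⁿ)⁺ − dim (𝒪/𝔪ⁿ)⁻ = Σ_{j<n} (−1)^j (j+1)² = (−1)^{n+1} n(n+1)/2`, never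
zero for `n ≥ 1` — every isolated `ι`-fixed point of the punctual Hilbert scheme of the node is UNBALANCED, so balanced junk there always lies
on a positive-dimensional orbit. Recorded: the closed form, by induction, and its non-vanishing. [report §2.5] -/
theorem fixed_ideals_unbalanced (n : ℕ) :
    2 * (∑ j ∈ range n, (-1 : ℤ) ^ j * ((j : ℤ) + 1) ^ 2) = (-1 : ℤ) ^ (n + 1) * n * (n + 1) ∧
    (1 ≤ n → (-1 : ℤ) ^ (n + 1) * n * (n + 1) ≠ 0) := by
  constructor
  · induction n with
    | zero => simp
    | succ n ih =>
      rw [sum_range_succ, mul_add, ih]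
      push_cast
      ring
  · intro hn h
    have h1 : ((-1 : ℤ) ^ (n + 1)) ≠ 0 := pow_ne_zero _ (by norm_num)
    have h2 : (n : ℤ) ≠ 0 := by exact_mod_cast (by omega : n ≠ 0)
    have h3 : ((n : ℤ) + 1) ≠ 0 := by positivity
    exact h3 (by
      rcases mul_eq_zero.mp h with h' | h'
      · rcases mul_eq_zero.mp h' with h'' | h''
        · exact absurd h'' h1
        · exact absurd h'' h2
      · exact h')

/-- THEOREM 1 (d), the two colengths that matter are not square-pyramidal: `n(n+1)(2n+1)/6 ∉ {2, 4}` for every `n` (values `0, 1, 5, 14, …`),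
so at a node NO `ι`-fixed ideal of colength `2` or `4` is isolated — consistent with (a)–(c). Recorded: the arithmetic. [report §2.5] -/
theorem two_four_not_pyramidal (n : ℕ) : n * (n + 1) * (2 * n + 1) ≠ 6 * 2 ∧ n * (n + 1) * (2 * n + 1) ≠ 6 * 4 := by
  rcases Nat.lt_or_ge n 3 with h | h
  · interval_cases n <;> norm_num
  · have h1 : 3 * 4 * 7 ≤ n * (n + 1) * (2 * n + 1) := by
      apply Nat.mul_le_mul (Nat.mul_le_mul h (by omega)) (by omega)
    constructor <;> omega

/-- THEOREM 3 (a), junk of length `2` at the carrier's node `c` (`Z_c = {z₃ = z₄ = z₁z₂ = 0}` in `ι`-linear coordinates; `D: f = z₁z₂C + z₃A + z₄B`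
even, `α = C(0)`): for `α ≠ 0`, `M = 𝓘_{Z_c}𝒪_{D,c} = (z₃, z₄)𝒪_D` with the single Koszul relation (regular sequence), `M/𝔪M = k₋²`, the balanced
length-`2` quotients are the cyclic ones `M → 𝒪/(𝔪² + H̃) ⊗ sgn`, `e₃ ↦ c₃ē`, `e₄ ↦ c₄ē`, with `c₃z₄ − c₄z₃ ∈ H̃`: a `ℙ²`-bundle over `ℙ¹`,
irreducible of dimension `1 + 2 = 3`; for `α = 0` (`M` needs the third generator `z₁z₂`): two irreducible `3`-dimensional families
(`[c₃:c₄:m]` with `H̃ ⊃ ⟨c₃z₄ − c₄z₃, c₃A₁ + c₄B₁⟩`: `2 + 1`; `H̃ ⊃ ⟨z₃, z₄⟩` with `(l₃, l₄) ∈ k²`: `1 + 2`) whose closures contain the split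
quotients. Recorded: the counts `≥ 2`. [report §4.2] -/
theorem quot_two_at_carrier_node :
    (1 : ℕ) + (4 - 1 - 1) = 3 ∧ (2 : ℕ) + 1 = 3 ∧ (1 : ℕ) + 2 = 3 ∧ 2 ≤ 3 := by
  norm_num

/-- THEOREM 3 (b), junk of length `4` at the carrier's node, `α ≠ 0`: `M/𝔪²M = (𝒪/𝔪²)²/k·(z̄₄, −z̄₃)` has dimension `2·5 − 1 = 9`, `𝔪M/𝔪²M`
dimension `7`; the non-cyclic balanced quotients (`T/𝔪T = k₋²`, `𝔪T = k₊²`, `𝔪²T = 0`) are the codimension-`2` subspaces of `𝔪M/𝔪²M`: the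
Grassmannian `Gr(5, 7)` of dimension `2·5 = 10`; the cyclic ones (`T = 𝒪/J ⊗ sgn`, `J` balanced of colength `4`, `c₃z₄ − c₄z₃ ∈ J`) form
families of dimension `≥ 3`. Recorded: `9`, `7`, `10`. [report §4.3] -/
theorem quot_four_at_carrier_node : (2 : ℕ) * 5 - 1 = 9 ∧ (9 : ℕ) - 2 = 7 ∧ (2 : ℕ) * (7 - 2) = 10 ∧ 2 ≤ 10 := by
  norm_num

/-- PROPOSITION 4 (a), the node excess: at a node `p` of `D` on `S_a` one has EXACT local coordinates `(x, y, z, w) = (θ_a, θ_{−a},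
∂_vθ_a + λθ_a, ∂_vθ_{−a})` with `D = {xw = yz}`, `S_a = {x = y = 0}`, `Γ_v(a) = {x = z = 0}`; along a branch of `Z` through `p` with
coordinate orders `o_x, o_y, o_z, o_w ≥ 1` the identity `xw = yz` gives `o_x + o_w = o_y + o_z`, and the excess
`δ_p := n_S(p) + n_Γ(p) − ord_p(θ_a|_Z) = min(o_x, o_y) + min(o_x, o_z) − o_x` is `≥ 1` (`= 1` for a transversal branch). Recorded: the
inequality. [report §5.1] -/
theorem node_branch_excess (ox oy oz ow : ℕ) (h : ox + ow = oy + oz) (hx : 1 ≤ ox) (hy : 1 ≤ oy) (hz : 1 ≤ oz) (hw : 1 ≤ ow) :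
    ox + 1 ≤ min ox oy + min ox oz ∧ ((ox = 1 ∧ oy = 1 ∧ oz = 1) → min ox oy + min ox oz = ox + 1) := by
  constructor
  · omega
  · omega

/-- PROPOSITION 4 (b), the numerics through nodes: with `𝓛 = 𝒪_D(Θ + Θ_a) ⊗ 𝓘_Γ` (first hull) the canonical quotient is
`T′ = 𝓛|_Z/torsion ≅ 𝒪_Z(Θ + Θ_a)(−(Γ ∩ Z))` of degree `16 − n_Γ`, so `χ(T) = 4` reads `n_Γ = 4 + ℓ` (second hull: `n_S = 4 + ℓ`), while
`n_S + n_Γ = (Θ_a·Z) + Σ_p δ_p = 8 + δ` with `δ ≥ 2` as soon as `Z` passes through a node (nodes on `Z` come in `ι`-pairs, `δ_p ≥ 1`). Hence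
a junk-free (R16-a) configuration has `n_S ≥ 6` (first hull) — `Z ∩ S_a` of length at least six. Recorded: the arithmetic. [report §5.2] -/
theorem r16a_numerics (nS nG δ ℓ : ℤ) (hsum : nS + nG = 8 + δ) (hG : nG = 4 + ℓ) (hℓ : ℓ = 0) (hδ : 2 ≤ δ) :
    nG = 4 ∧ nS = 4 + δ ∧ 6 ≤ nS := by
  subst hℓ; omega

/-- PROPOSITION 4 (c), the (R16-a) sub-incidence table (`h⁺ = 5`, `d′ ∈ {1, 2}`): a component of [XVI] 3.2's incidence over a rank-`ρ`
stratum has dimension `≥ N(ρ, d′) = max(0, 4 + d′ − (5 − ρ)²) + (4 − ρ)`; 'D singular at a point of `Z ∩ S_a`' is the codimension-`2` linear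
condition `v ∈ T_pS_a` on `ℙ(Λ_a)`, which costs `2` in the fibre for `ρ ≤ 2` (fibre `ℙ^{4−ρ}`, `4 − ρ ≥ 2`), `1` on the base and `0` in the fibre
for `ρ = 3`, and `2` on the base for `ρ = 4`; the resulting lower bounds are `2, 1, 0` (`ρ = 0, 1, 2`), `d′ − 1` (`ρ = 3`), `1 + d′` (`ρ = 4`):
the family mechanism is silent (bound `≤ 1`) exactly for `ρ ∈ {1, 2, 3}`, and rigid candidates (bound `0`) occur only at `ρ = 2` and
`(ρ, d′) = (3, 1)`. Recorded: the table. [report §5.3] -/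
theorem r16a_subincidence_table (ρ d : ℕ) (hρ : ρ ≤ 4) (hd : d = 1 ∨ d = 2) :
    (2 : ℤ) ≤ max (4 + (d : ℤ) - (5 - (ρ : ℤ)) ^ 2) 0 + (4 - (ρ : ℤ)) ∧
    (max (4 + (d : ℤ) - (5 - (ρ : ℤ)) ^ 2) 0 + (4 - (ρ : ℤ)) - 2 ≤ 1 ↔ (ρ = 1 ∨ ρ = 2 ∨ ρ = 3)) ∧
    (max (4 + (d : ℤ) - (5 - (ρ : ℤ)) ^ 2) 0 + (4 - (ρ : ℤ)) - 2 ≤ 0 ↔ (ρ = 2 ∨ (ρ = 3 ∧ d = 1))) := by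
  rcases hd with h | h <;> subst h <;> interval_cases ρ <;> norm_num

end H2TorsionJunk

section H2TorsionJunkAddendumA

/-!
## ADDENDUM A (report §8): (R16-a) — flat limits land on the canonical sheaf exactly at the candidates

LEMMA FL: along an arc of junk-free H2-numerical configurations `w_t → w₀` in the equisingular incidence, the flat limit of
`F(w_t) = ker(𝓛_t → 𝓛_t|_{Z_t}^{tf})` is contained in the canonical sheaf `F(w₀)` with quotient of length `n(w₀) − 4 ≥ 0` (`n = n_Γ` for the
hull `𝒪_D(Θ + S_a)`, `n = n_S` for `𝒪_D(2Θ − S_a)`; `χ(𝓛₀|_{Z₀}^{tf}) = 16 − n(w₀) − 8`), so it IS the canonical sheaf iff `n(w₀) = 4`, i.e. iff `w₀`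
is an (R16-a) candidate. THEOREM 4: hence every candidate lying on (the closure of) an irreducible family of dimension `≥ 2` of junk-free
H2-numerical configurations is dead (generic flatness + the family mechanism + its flat-limit clause); for the second hull the `n ≡ 4` incidence
over `{n_S = 4, ρ ≤ 4}` has components of dimension `≥ N₂(ρ) = max(0, 2 + d′ − (5 − ρ)²) + (4 − ρ) = 4, 3, 2, 1, 1 + d′`, so only `ρ = 3` can
carry a survivor (a 1-dimensional entirely-nodal pencil family, expected empty); for the first hull the expected-finite cell `ρ = 4, n_S = 6`
is a limit of [XVI]'s node-free families and is dead barring excess. ERRATUM E-P3g25-1 corrects report 5.4's last sentences accordingly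
(`r16a_subincidence_table` keeps its meaning as the count on the sub-incidence `S`).
-/

/-- LEMMA FL (report 8.1): the flat limit `Q = 𝓛₀/F_lim` has `χ(Q) = 4` and pure quotient `Q″ = 𝓛₀|_{Z₀}^{tf}` of Euler characteristic
`16 − n − 8`; the junk `Q_tors` of the limit therefore has length `ℓ_lim = 4 − (16 − n − 8) = n − 4`, which is `≥ 0` iff `n ≥ 4` (semicontinuity)
and `= 0` — the limit IS the canonical sheaf — iff `n = 4` (the candidate condition). Recorded: the arithmetic. -/
theorem flat_limit_junk_length (n ℓ : ℤ) (hχ : (16 - n - 8) + ℓ = 4) :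
    ℓ = n - 4 ∧ (0 ≤ ℓ ↔ 4 ≤ n) ∧ (ℓ = 0 ↔ n = 4) ∧ (n = 6 → ℓ = 2) ∧ (n = 8 → ℓ = 4) := by
  refine ⟨by omega, by omega, by omega, by omega, by omega⟩

/-- Report 8.3 (a)/(c): the base loci `{n_S ≥ 2k}` (`a` on `k` theta-intersection surfaces `S_{z_i}`, `z_i ∈ Z`: incidence of dimension
`(4 + d′) + k − 2k`, finite over its image) have all components of dimension `≥ 4 + d′ − k`: `2 + d′`, `1 + d′`, `d′` for `k = 2, 3, 4`; with the
rank condition `ρ ≤ 4` (codimension `≤ 1`) resp. `ρ ≤ 3` (codimension `≤ 4`) the EXPECTED dimensions of the cells of 8.3 (d) are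
`(1 + d′) − 1 − 2 = d′ − 2` (first hull, `ρ = 4`, `n_S = 6`, one nodal pair), `(2 + d′) − 4 = d′ − 2` (second hull, `ρ ≤ 3`) and
`(1 + d′) − 4 < 0` (first hull, `ρ ≤ 3`), for `d′ ∈ {1, 2}`. Recorded: the arithmetic. -/
theorem base_loci_dims (d k : ℤ) (hd : d = 1 ∨ d = 2) :
    (4 + d) + k - 2 * k = 4 + d - k ∧ (4 + d - 2 = 2 + d ∧ 4 + d - 3 = 1 + d ∧ 4 + d - 4 = d) ∧
    ((1 + d) - 1 - 2 = d - 2 ∧ d - 2 ≤ 0) ∧ ((2 + d) - 4 = d - 2) ∧ ((1 + d) - 4 < 0) := by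
  rcases hd with h | h <;> subst h <;> omega

/-- Report 8.3 (b): for the hull `𝒪_D(2Θ − S_a)` the candidate base `{n_S = 4}` has components of dimension `≥ 2 + d′`, so the `n ≡ 4`
incidence over its rank strata has components of dimension `≥ N₂(ρ, d′) := max(0, 2 + d′ − (5 − ρ)²) + (4 − ρ)`, i.e. `4, 3, 2, 1, 1 + d′` for
`ρ = 0, …, 4`; by THEOREM 4 (a) only components of dimension `≤ 1` can carry a survivor: exactly `ρ = 3`. Recorded: the table. -/
theorem limit_cells_second_hull (ρ d : ℕ) (hρ : ρ ≤ 4) (hd : d = 1 ∨ d = 2) :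
    (max (2 + (d : ℤ) - (5 - (ρ : ℤ)) ^ 2) 0 + (4 - (ρ : ℤ)) ≤ 1 ↔ ρ = 3) ∧
    (ρ = 3 → max (2 + (d : ℤ) - (5 - (ρ : ℤ)) ^ 2) 0 + (4 - (ρ : ℤ)) = 1) ∧
    (ρ = 4 → max (2 + (d : ℤ) - (5 - (ρ : ℤ)) ^ 2) 0 + (4 - (ρ : ℤ)) = 1 + d) := by
  rcases hd with h | h <;> subst h <;> interval_cases ρ <;> norm_num

end H2TorsionJunkAddendumA

section H2TorsionJunkAddendumB

/-!
## ADDENDUM B (report §9): the RANK LEMMA ρ(a, Z) ≤ 5 − n_S(a, Z)/2 and its consequences for (R16-a)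

Every section of `Λ_a = H⁰(𝓘_{S_a}(2Θ))` vanishes on `S_a`, hence on `W = Z ∩ S_a ⊂ Z` (length `n_S = 2k`), so
`res_Z(Λ_a) ⊂ {s ∈ res_Z H⁰(2Θ) : s|_W = 0}`. For an étale Abel–Prym carrier `res_Z H⁰(2Θ) = f^*H⁰(C, K_C)` ([XVII] PROP 2.4) and the
condition is `div t ≥ B`, `B` of degree `k` on the genus-`5` curve `C`, whence `ρ ≤ h⁰(K_C − B) = 4 − k + h⁰(B) = 5 − k` for `k ≤ 3`
(`C` non-hyperelliptic, non-trigonal — automatic on a general fourfold by Recillas / Mumford); for a nodal carrier `ρ ≤ h⁰(M₊(−B)) = 5 − k`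
given `M₊ ≅ K_C(x + y)` ([XVII] THM 3, (F1)–(F2)), `≤ 6 − k` unconditionally. CONSEQUENCES (THEOREM 5): junk-free H2 configurations
(`n_S = 4`) have `ρ ≤ 3` — pencils at least; for the second hull every (R16-a) candidate lies on an irreducible `n ≡ 4` family of dimension
`≥ 2` (the fibre `ℙ^{4−ρ}` if `ρ ≤ 2`; the `ℙ¹`-bundle over a component of `{n_S ≥ 4}`, of dimension `≥ (1 + d′) + 1`, if `ρ = 3`) and is
DEAD by THEOREM 4; for the first hull (`n_S = 6`, one nodal pair) the family `ℙ(K ∩ Λ^{(p)})` over the three-orbit locus has dimension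
`≥ (1 + d′) + (2 − ρ) ≥ 2` off rank-jump points — DEAD there; the residual consists of named rank-jump / tangency / `n_S = 8` cells —
of expected dimension `d′ − 1 ∈ {0, 1}` over the base, NOT negative (ERRATUM E-P3g25-2, report §10.1; the 'negative' count of
report 9.2 (c) was per fibre). SEQUEL ([XIX], `WeilTypeLadderH2UniformPlane.lean`): `n_S = 8` forces `2a = 0`, so the `n_S = 8` cell
is void on `A°`, and the rank-jump / tangency cells are dead by the uniform plane lemma — the row (R16-a) is DEAD on a general fourfold
(nodal carriers given (F1)–(F2)).
-/

/-- RANK LEMMA (report 9.1), the Riemann–Roch bookkeeping: on a curve of genus `g` and for an effective `B` of degree `k`,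
`h⁰(K − B) = (2g − 2 − k) − g + 1 + h⁰(B) = g − 1 − k + h⁰(B)`; for `g = 5` this is `4 − k + h⁰(B)`, `= 5 − k` when `h⁰(B) = 1` (`k ≤ 3` on a
non-hyperelliptic non-trigonal curve); for the nodal carriers (`g = 4`, `M₊` of degree `8`): `h⁰(M₊(−B)) = (8 − k) − 4 + 1 + h¹ = 5 − k + h¹`
with `h¹ = 0` under `M₊ ≅ K_C(x + y)` and `h¹ ≤ 1` otherwise. Hence `n_S ≥ 4 ⇒ ρ ≤ 3`, `n_S ≥ 6 ⇒ ρ ≤ 2`. Recorded: the arithmetic. -/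
theorem rank_lemma_bound (g k h0B h0KB : ℤ) (rr : h0KB - h0B = (2 * g - 2 - k) - g + 1) :
    h0KB = g - 1 - k + h0B ∧
    (g = 5 → h0B = 1 → h0KB = 5 - k) ∧
    (g = 5 → h0B = 1 → ((k = 2 → h0KB = 3) ∧ (k = 3 → h0KB = 2))) ∧
    (∀ h1 : ℤ, 0 ≤ h1 → h1 ≤ 1 → (8 - k) - 4 + 1 + h1 ≤ 6 - k ∧ ((8 - k) - 4 + 1 + 0 = 5 - k)) := by
  refine ⟨by omega, by omega, ?_, ?_⟩
  · intro hg hb; constructor <;> intro hk <;> omega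
  · intro h1 h1a h1b; constructor <;> omega

/-- THEOREM 5 (b) (report 9.2), second hull: a junk-free candidate has `n_S = 4`, hence `ρ ≤ 3` and a fibre `ℙ^{4−ρ}` of dimension
`4 − ρ ≥ 1`; if `ρ ≤ 2` the fibre alone is a family of dimension `≥ 2`; if `ρ = 3` every component of `{n_S ≥ 4}` through the point has
dimension `≥ (4 + d′ + 2) − 4 = 2 + d′` (two reduced orbits) or `≥ (4 + d′ + 1) − 4 = 1 + d′` (one orbit of length two), in all cases
`≥ 1 + d′ ≥ 2`, and the `ℙ¹`-bundle over it has dimension `≥ 2 + d′ ≥ 3`. Either way the candidate lies on an irreducible `n ≡ 4` family of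
dimension `≥ 2`: DEAD by THEOREM 4. Recorded: the arithmetic for `d′ ∈ {1, 2}`, `1 ≤ ρ ≤ 3`. -/
theorem second_hull_family_dims (d ρ : ℤ) (hd : d = 1 ∨ d = 2) (hρ : 1 ≤ ρ ∧ ρ ≤ 3) :
    1 ≤ 4 - ρ ∧ (ρ ≤ 2 → 2 ≤ 4 - ρ) ∧
    ((4 + d + 2) - 4 = 2 + d ∧ (4 + d + 1) - 4 = 1 + d ∧ 2 ≤ 1 + d) ∧
    (ρ = 3 → 2 ≤ (1 + d) + (4 - ρ) ∧ 3 ≤ (1 + d) + (4 - ρ)) := by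
  rcases hd with h | h <;> subst h <;> refine ⟨by omega, by omega, by omega, by omega⟩

/-- THEOREM 5 (c) (report 9.2), first hull: a junk-free candidate has `n_S = 4 + δ ∈ {6, 8}` (`δ ≥ 2` even), hence `ρ ≤ 2`; in the main case
`n_S = 6` the three-orbit locus has components of dimension `≥ (4 + d′ + 3) − 6 = 1 + d′`, the kernel `K = ker res` has rank `5 − ρ ≥ 3`,
`K ∩ Λ^{(p)}` has fibre dimension `≥ (5 − ρ) + 3 − 5 = 3 − ρ ≥ 1`, and the family `ℙ(K ∩ Λ^{(p)})` over the locus has dimension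
`≥ (1 + d′) + (2 − ρ) ≥ 2` — DEAD off rank-jump points; for `n_S = 8` the 'two nodal pairs' condition in the fibre has expected dimension
`(5 − ρ) + 3 + 3 − 10 − 1 = −ρ < 0` PER FIBRE (over the `d′`-dimensional base the cell's expected dimension is `d′ − 1 ≥ 0`: ERRATUM
E-P3g25-2, report §10.1; and the cell is VOID on `A°` by [XIX] THEOREM A). Recorded: the arithmetic for `d′ ∈ {1, 2}`, `1 ≤ ρ ≤ 2`. -/
theorem first_hull_family_dims (d ρ δ nS : ℤ) (hd : d = 1 ∨ d = 2) (hρ : 1 ≤ ρ ∧ ρ ≤ 2)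
    (hn : nS = 4 + δ) (hδ : 2 ≤ δ) (hδeven : δ % 2 = 0) (hn8 : nS ≤ 8) :
    (nS = 6 ∨ nS = 8) ∧ ((4 + d + 3) - 6 = 1 + d) ∧ (3 ≤ 5 - ρ) ∧ (1 ≤ (5 - ρ) + 3 - 5) ∧
    (2 ≤ (1 + d) + (2 - ρ)) ∧ ((5 - ρ) + 3 + 3 - 10 - 1 = -ρ ∧ -ρ < 0) := by
  rcases hd with h | h <;> subst h <;> refine ⟨by omega, by omega, by omega, by omega, by omega, by omega⟩

end H2TorsionJunkAddendumB

section H2TorsionJunkAddendumC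

/-- ADDENDUM C (report §10), PROPOSITION 6 — the cell (c3) made explicit: on `{n_S = 8}` the carrier meets `S_a` in `f^*B` for an odd
theta-characteristic `B` of the genus-`5` curve with `B ⊗ η` even — `2⁸ = 256` of the `2⁴(2⁵ − 1) = 496` odd ones —, `ρ = h⁰(B) = 1` so the
members through `Z` form `ℙ(ker) ≅ ℙ(T₀A) = ℙ³` (`dim ker = 5 − 1 = 4`), a member is nodal at two of the four pairs iff two tangent `2`-planes of
`S_a` in the `4`-dimensional `T₀A` meet, i.e. iff one `4 × 4` determinant of Gauss images vanishes (expected intersection `2 + 2 − 4 = 0`, one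
condition), the resulting canonical sheaf has `n_Γ = 8 + 4 − 8 = 4` (H2-numerical), and over the `d′`-dimensional base the cell has EXPECTED
dimension `d′ − 1 ∈ {0, 1}` — NOT negative (ERRATUM E-P3g25-2 to report 9.2/9.4): a curve of parameter-free candidates for étale carriers,
finitely many for nodal ones. Recorded: the arithmetic. -/
theorem cell_c3_counts (d : ℤ) (hd : d = 1 ∨ d = 2) :
    (2 : ℤ) ^ 4 * (2 ^ 5 - 1) = 496 ∧ (2 : ℤ) ^ 8 = 256 ∧ (256 : ℤ) ≤ 496 ∧ (5 : ℤ) - 1 = 4 ∧ (2 : ℤ) + 2 - 4 = 0 ∧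
    (8 : ℤ) + 4 - 8 = 4 ∧ 0 ≤ d - 1 ∧ d - 1 ≤ 1 := by
  rcases hd with h | h <;> subst h <;> norm_num

end H2TorsionJunkAddendumC

end Summit.HodgeConjecture.HodgeConjecture.WeilTypeLadder
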